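import Summits.Ventures.PercRepro.RankLevelSetF

/-!
# PercRepro — THE CIRCUIT COUNT AT BOUNDED NULLITY: `#{circuits with k + 1 elements} ≤ C(ν + k, k + 1)`
(night-1, gen 4)

`proofs/NIGHT-1-C025-induction.md` §15. A finite matroid of nullity `ν` (`M✶.eRank = ν`, i.e. `|E| = r(M) + ν`) has
at most `C(ν + k, k + 1)` circuits with `k + 1` elements — sharp on the uniform matroid `U_{k, ν + k}`, whose
`C(ν + k, k + 1)` sets of `k + 1` elements are all circuits. This replaces Corollary N′'s `2^{(q+1)ν}` bound on the
number of circuits with `≤ q + 1` elements (`ncard_circuitsLE_le`) by the binomial `C(ν + q + 1, q + 1) − 1`.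

PROOF (deletion / contraction induction on `|E|`). If there is no such circuit there is nothing to prove; otherwise
pick `e` in one of them. `e` is not a coloop, so `M ＼ {e}` has nullity `ν − 1` (`dual_eRank_delete_singleton_add_one`)
and the circuits AVOIDING `e` are its `(k+1)`-circuits (`delete_isCircuit_iff`): at most `C(ν − 1 + k, k + 1)`.
The circuits THROUGH `e` inject by `C ↦ C ∖ {e}` into the `k`-circuits of `M ／ {e}`
(`IsCircuit.contractElem_isCircuit`), which has nullity `ν` (`dual_eRank_contract_singleton`; `e` is not a loop when
`k ≥ 1`): at most `C(ν + k − 1, k)`; for `k = 0` the only circuit through `e` is `{e}`. Pascal's rule adds up.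

* `eRank_delete_singleton_of_not_isColoop`, `dual_eRank_delete_singleton_add_one` — `r(M ＼ {e}) = r(M)` and
  `ν(M ＼ {e}) + 1 = ν(M)` for a non-coloop `e`;
* `eRank_contract_singleton_add_one`, `dual_eRank_contract_singleton` — `r(M ／ {e}) + 1 = r(M)` and
  `ν(M ／ {e}) = ν(M)` for a non-loop `e`;
* **`ncard_circuits_le_choose`** — the count.
Axioms: standard.
-/

open scoped Matroid

namespace PercRepro

namespace Matroid

open Set

variable {α : Type} {M : _root_.Matroid α}

/-- `r(M ＼ {e}) = r(M)` for a non-coloop `e ∈ E`. -/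
theorem eRank_delete_singleton_of_not_isColoop {e : α} (he : e ∈ M.E) (hne : ¬ M.IsColoop e) :
    (M ＼ {e}).eRank = M.eRank := by
  have hcl : e ∈ M.closure (M.E \ {e}) := by
    by_contra h
    exact hne ((_root_.Matroid.isColoop_iff_notMem_closure_compl he).2 h)
  rw [_root_.Matroid.eRank_def, _root_.Matroid.eRank_def, _root_.Matroid.delete_ground,
    delete_singleton_eRk_eq (subset_refl _), ← eRk_insert_eq_of_mem_closure sdiff_subset hcl,
    insert_sdiff_singleton, insert_eq_of_mem he]

/-- A finite matroid has finite rank: `r(M) ≠ ⊤`. -/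
theorem eRank_ne_top_of_finite (M : _root_.Matroid α) [M.Finite] : M.eRank ≠ ⊤ :=
  ne_top_of_le_ne_top M.ground_finite.encard_lt_top.ne (_root_.Matroid.eRank_le_encard_ground M)

/-- **The nullity drops by one when a non-coloop is deleted**: `ν(M ＼ {e}) + 1 = ν(M)` (`ν = M✶.eRank`). -/
theorem dual_eRank_delete_singleton_add_one [M.Finite] {e : α} (he : e ∈ M.E) (hne : ¬ M.IsColoop e) :
    (M ＼ {e})✶.eRank + 1 = M✶.eRank := by
  have h1 := _root_.Matroid.eRank_add_eRank_dual M
  have h2 := _root_.Matroid.eRank_add_eRank_dual (M ＼ {e})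
  rw [eRank_delete_singleton_of_not_isColoop he hne, _root_.Matroid.delete_ground] at h2
  have h3 : (M.E \ {e}).encard + 1 = M.E.encard := encard_sdiff_singleton_add_one he
  have h4 : M.eRank + ((M ＼ {e})✶.eRank + 1) = M.eRank + M✶.eRank := by
    rw [← add_assoc, h2, h3, h1]
  exact WithTop.add_left_cancel (eRank_ne_top_of_finite M) h4

/-- `r(M ／ {e}) + 1 = r(M)` for a non-loop `e`. -/
theorem eRank_contract_singleton_add_one {e : α} (he : M.Indep {e}) :
    (M ／ {e}).eRank + 1 = M.eRank := by
  have heE : e ∈ M.E := he.subset_ground (mem_singleton e)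
  rw [_root_.Matroid.eRank_def, _root_.Matroid.eRank_def, _root_.Matroid.contract_ground,
    contract_singleton_eRk_add_one he (subset_refl _), insert_sdiff_singleton, insert_eq_of_mem heE]

/-- **The nullity is unchanged when a non-loop is contracted**: `ν(M ／ {e}) = ν(M)`. -/
theorem dual_eRank_contract_singleton [M.Finite] {e : α} (he : M.Indep {e}) :
    (M ／ {e})✶.eRank = M✶.eRank := by
  have heE : e ∈ M.E := he.subset_ground (mem_singleton e)
  have h1 := _root_.Matroid.eRank_add_eRank_dual M
  have h2 := _root_.Matroid.eRank_add_eRank_dual (M ／ {e})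
  rw [_root_.Matroid.contract_ground] at h2
  have h3 : (M.E \ {e}).encard + 1 = M.E.encard := encard_sdiff_singleton_add_one heE
  have h4 := eRank_contract_singleton_add_one he
  have h5 : M.eRank + (M ／ {e})✶.eRank = M.eRank + M✶.eRank := by
    rw [h1, ← h3, ← h2, ← h4]; ring
  exact WithTop.add_left_cancel (eRank_ne_top_of_finite M) h5

/-- **THE CIRCUIT COUNT AT BOUNDED NULLITY.** A finite matroid of nullity `ν` (`M✶.eRank = ν`) has at most
`C(ν + k, k + 1)` circuits with `k + 1` elements (sharp on `U_{k, ν+k}`). Deletion / contraction induction on `|E|`: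
the circuits avoiding an element `e` of some such circuit are those of `M ＼ {e}` (nullity `ν − 1`), the circuits
through `e` inject into the `k`-circuits of `M ／ {e}` (nullity `ν`), and Pascal's rule adds up. -/
theorem ncard_circuits_le_choose (M : _root_.Matroid α) [M.Finite] {ν : ℕ} (hν : M✶.eRank = (ν : ℕ∞)) (k : ℕ) :
    {C | M.IsCircuit C ∧ C.ncard = k + 1}.ncard ≤ (ν + k).choose (k + 1) := by
  suffices H : ∀ n : ℕ, ∀ (M : _root_.Matroid α) [M.Finite], M.E.ncard = n → ∀ (ν k : ℕ),
      M✶.eRank = (ν : ℕ∞) → {C | M.IsCircuit C ∧ C.ncard = k + 1}.ncard ≤ (ν + k).choose (k + 1) from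
    H _ M rfl ν k hν
  intro n
  induction n using Nat.strong_induction_on with
  | _ n ih =>
  intro M _ hn ν k hν
  classical
  set S := {C | M.IsCircuit C ∧ C.ncard = k + 1} with hS
  have hSfin : S.Finite := M.ground_finite.finite_subsets.subset (fun C hC => hC.1.subset_ground)
  by_cases hSe : S = ∅
  · rw [hSe, ncard_empty]; exact Nat.zero_le _
  obtain ⟨C₀, hC₀⟩ := nonempty_iff_ne_empty.2 hSe
  obtain ⟨e, heC₀⟩ := hC₀.1.nonempty
  have heE : e ∈ M.E := hC₀.1.subset_ground heC₀
  -- `e` lies in a circuit, so it is not a coloop: `M ＼ {e}` has nullity `ν − 1`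
  have hne : ¬ M.IsColoop e := hC₀.1.not_isColoop_of_mem heC₀
  have hdel := dual_eRank_delete_singleton_add_one heE hne
  rw [hν] at hdel
  have hfin' : (M ＼ {e})✶.eRank ≠ ⊤ := by
    intro h
    rw [h] at hdel
    exact absurd hdel (by simp)
  obtain ⟨ν', hν'⟩ := ENat.ne_top_iff_exists.1 hfin'
  have hνν' : ν = ν' + 1 := by
    rw [← hν'] at hdel
    exact_mod_cast hdel.symm
  have hdelE : (M ＼ {e}).E.ncard < n := by
    rw [_root_.Matroid.delete_ground, ← hn, ← ncard_sdiff_singleton_add_one heE M.ground_finite]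
    omega
  -- split the circuits by whether they contain `e`
  set S₁ := {C | M.IsCircuit C ∧ C.ncard = k + 1 ∧ e ∈ C} with hS₁
  set S₂ := {C | M.IsCircuit C ∧ C.ncard = k + 1 ∧ e ∉ C} with hS₂
  have hsplit : S ⊆ S₁ ∪ S₂ := by
    intro C hC
    by_cases h : e ∈ C
    · exact Or.inl ⟨hC.1, hC.2, h⟩
    · exact Or.inr ⟨hC.1, hC.2, h⟩
  have hS₁fin : S₁.Finite := hSfin.subset (fun C hC => ⟨hC.1, hC.2.1⟩)
  have hS₂fin : S₂.Finite := hSfin.subset (fun C hC => ⟨hC.1, hC.2.1⟩)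
  -- the circuits avoiding `e` are the `(k+1)`-circuits of `M ＼ {e}`
  have h2 : S₂.ncard ≤ (ν' + k).choose (k + 1) := by
    have hsub : S₂ ⊆ {C | (M ＼ {e}).IsCircuit C ∧ C.ncard = k + 1} := by
      intro C hC
      exact ⟨_root_.Matroid.delete_isCircuit_iff.2 ⟨hC.1, disjoint_singleton_right.2 hC.2.2⟩, hC.2.1⟩
    calc S₂.ncard ≤ {C | (M ＼ {e}).IsCircuit C ∧ C.ncard = k + 1}.ncard :=
          ncard_le_ncard hsub
            ((M ＼ {e}).ground_finite.finite_subsets.subset (fun C hC => hC.1.subset_ground))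
      _ ≤ (ν' + k).choose (k + 1) := ih _ hdelE (M ＼ {e}) rfl ν' k hν'.symm
  -- the circuits through `e`
  have h1 : S₁.ncard ≤ (ν' + k).choose k := by
    rcases k with _ | k
    · -- `k = 0`: the only `1`-element circuit through `e` is `{e}`
      have hsub : S₁ ⊆ {{e}} := by
        intro C hC
        obtain ⟨a, ha⟩ := ncard_eq_one.1 hC.2.1
        have hea : e ∈ ({a} : Set α) := ha ▸ hC.2.2
        rw [mem_singleton_iff] at hea
        rw [mem_singleton_iff, ha, hea]
      calc S₁.ncard ≤ ({{e}} : Set (Set α)).ncard := ncard_le_ncard hsub (finite_singleton _)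
        _ = 1 := ncard_singleton _
        _ = (ν' + 0).choose 0 := by simp
    · -- `k + 1 ≥ 1`: `C ↦ C ∖ {e}` injects into the `(k+1)`-circuits of `M ／ {e}`
      have heI : M.Indep {e} := by
        rw [_root_.Matroid.indep_singleton, ← _root_.Matroid.not_isLoop_iff heE]
        intro hloop
        have hC₀e : C₀ = {e} := hloop.eq_of_isCircuit_mem hC₀.1 heC₀
        have := hC₀.2
        rw [hC₀e, ncard_singleton] at this
        omega
      have hconE : (M ／ {e}).E.ncard < n := by
        rw [_root_.Matroid.contract_ground, ← hn, ← ncard_sdiff_singleton_add_one heE M.ground_finite]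
        omega
      have hνc : (M ／ {e})✶.eRank = (ν : ℕ∞) := by rw [dual_eRank_contract_singleton heI, hν]
      let f : Set α → Set α := fun C => C \ {e}
      have hmaps : ∀ C ∈ S₁, f C ∈ {C' | (M ／ {e}).IsCircuit C' ∧ C'.ncard = k + 1} := by
        intro C hC
        have hCfin : C.Finite := M.ground_finite.subset hC.1.subset_ground
        refine ⟨hC.1.contractElem_isCircuit ?_ hC.2.2, ?_⟩
        · have h1lt : 1 < C.ncard := by rw [hC.2.1]; omega
          obtain ⟨a, ha, b, hb, hab⟩ := (one_lt_ncard hCfin).1 h1lt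
          exact ⟨a, ha, b, hb, hab⟩
        · have h3 := ncard_sdiff_singleton_add_one hC.2.2 hCfin
          have h4 := hC.2.1
          simp only [f]
          omega
      have hinj : InjOn f S₁ := by
        intro C hC C' hC' h
        have e1 : C = insert e (C \ {e}) := by rw [insert_sdiff_singleton, insert_eq_of_mem hC.2.2]
        have e2 : C' = insert e (C' \ {e}) := by rw [insert_sdiff_singleton, insert_eq_of_mem hC'.2.2]
        rw [e1, e2]
        simp only [f] at h
        rw [h]
      have hk : ν + k = ν' + (k + 1) := by omega
      calc S₁.ncard ≤ {C' | (M ／ {e}).IsCircuit C' ∧ C'.ncard = k + 1}.ncard :=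
            ncard_le_ncard_of_injOn f hmaps hinj
              ((M ／ {e}).ground_finite.finite_subsets.subset (fun C hC => hC.1.subset_ground))
        _ ≤ (ν + k).choose (k + 1) := ih _ hconE (M ／ {e}) rfl ν k hνc
        _ = (ν' + (k + 1)).choose (k + 1) := by rw [hk]
  -- Pascal
  have hk' : ν + k = ν' + k + 1 := by omega
  calc S.ncard ≤ (S₁ ∪ S₂).ncard := ncard_le_ncard hsplit (hS₁fin.union hS₂fin)
    _ ≤ S₁.ncard + S₂.ncard := ncard_union_le _ _
    _ ≤ (ν' + k).choose k + (ν' + k).choose (k + 1) := add_le_add h1 h2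
    _ = (ν' + k + 1).choose (k + 1) := (Nat.choose_succ_succ' (ν' + k) k).symm
    _ = (ν + k).choose (k + 1) := by rw [hk']

/-- The count in the form used by the level-`4` arithmetic: with `|E| = r(M) + ν` (as `encard`), the circuits with
`k + 1` elements number at most `C(ν + k, k + 1)`. -/
theorem ncard_circuits_le_choose_of_encard (M : _root_.Matroid α) [M.Finite] {ν : ℕ}
    (hd : M.E.encard = M.eRank + ν) (k : ℕ) :
    {C | M.IsCircuit C ∧ C.ncard = k + 1}.ncard ≤ (ν + k).choose (k + 1) := by
  apply ncard_circuits_le_choose M _ k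
  have h := _root_.Matroid.eRank_add_eRank_dual M
  rw [hd] at h
  exact WithTop.add_left_cancel (eRank_ne_top_of_finite M) h

end Matroid

end PercRepro
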